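import Summits.SmoothPoincare4.Statement
import Literature.Topology.FourManifolds.GroupTrisections
import Literature.Topology.FourManifolds.Trisections
import Literature.Topology.FourManifolds.TrisectionFunctor

/-!
# SmoothPoincare4 — route GroupTrisection: re-marking absorbs isomorphism

For a trisection `h` of `X` with central-surface base point `x₀` and marking
`μ : S_g ≃* π₁(Σ, x₀)`, the kernel triple `groupTrisectionOf h x₀ μ` is defined by pulling back the
three kernels along `μ`. If it is isomorphic (one automorphism `α` of `S_g` carrying `Kᵢ` onto
`K'ᵢ` for all `i`) to a triple `K'`, then `K'` is *equal* to the kernel triple of the same trisection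
for the re-marked identification `μ' := μ ∘ α⁻¹` (Abrams–Gay–Kirby 2018, §2: isomorphism of group
trisections = change of marking). This removes the need for a congruence
`Iso K K' → Iso K.stabilize K'.stabilize` when iterating stabilisation in the route's assembly.
Elementary (12 lines; script due to grounder-ground-B-0). [folklore]
-/

open scoped Manifold ContDiff
open ContinuousMap

namespace Literature.SPC4.GroupTrisection

/-- Settles stmt-SmoothPoincare4-0526: an isomorphism from `groupTrisectionOf h x₀ μ` to `K'` is
absorbed by re-marking, `groupTrisectionOf h x₀ (α⁻¹ ≫ μ) = K'`. [folklore] -/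
theorem remarking_absorbs_iso : ∀ (X : Type) [TopologicalSpace X] [ChartedSpace (EuclideanSpace ℝ (Fin 4)) X] (g : ℕ) (k : Fin 3 → ℕ) (S : Fin 3 → Set X) (h : Literature.Topology.FourManifolds.IsTrisection X g k S) (x₀ : Literature.Topology.FourManifolds.centralSurface S) (μ : Literature.Topology.FourManifolds.SurfaceGroup g ≃* FundamentalGroup (Literature.Topology.FourManifolds.centralSurface S) x₀) (K' : Literature.Topology.FourManifolds.TrisectionKernels g), Literature.Topology.FourManifolds.TrisectionKernels.Iso (Literature.Topology.FourManifolds.groupTrisectionOf h x₀ μ) K' → ∃ μ' : Literature.Topology.FourManifolds.SurfaceGroup g ≃* FundamentalGroup (Literature.Topology.FourManifolds.centralSurface S) x₀, Literature.Topology.FourManifolds.groupTrisectionOf h x₀ μ' = K' := by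
  intro X _ _ g k S h x₀ μ K2 hI
  obtain ⟨α, hα⟩ := hI
  refine ⟨α.symm.trans μ, ?_⟩
  funext i
  rw [← hα i]
  ext γ
  simp only [Literature.Topology.FourManifolds.groupTrisectionOf, Subgroup.mem_comap, Subgroup.mem_map, MulEquiv.coe_toMonoidHom,
    MulEquiv.trans_apply]
  constructor
  · intro hγ
    exact ⟨α.symm γ, hγ, by simp⟩
  · rintro ⟨δ, hδ, rfl⟩
    simpa using hδ

end Literature.SPC4.GroupTrisection
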